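/-
Copyright (c) 2026. All rights reserved.
Released under Apache 2.0 license as described in the file LICENSE.
-/
import Literature.NumberTheory.ComplexMultiplication.DegenerateCMTypesCyclicTwoOddPrimes
import Literature.NumberTheory.ComplexMultiplication.DegenerateCMTypesCompositeDimension
import HarnessLib

/-!
# The CM types of a cyclic group of order `2p²` and their ranks: Dodson's "minimal group calculations in
# dimension 9" (`⟨ρ⟩ × ℤ₉`: ranks `10, 8, 4, 2`) for every odd prime `p` — group level

B. Dodson, *On the Mumford–Tate group of an abelian variety with complex multiplication*, J. Algebra **111**
(1987) 49–73 [Dodson1987] (held text `paper:doi-10-1016-0021-8693-87-90242-0`, §4 pp. 69–71 = p0021–p0023),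
computes the ranks of the CM types on the "minimal groups" `⟨ρ⟩ × R₀` of degree `9`:

> §4.1, PROPOSITION 4.1. "Let `f ∈ ℤ₂⁹` define a type on `⟨ρ⟩ × R₀`, for `R₀` one of the two regular groups of
> degree `9`. Then the type defined by `f` is nondegenerate whenever weight(`f`) is relatively prime to `3`."
> (proof: "if a subgroup of `R₀` stabilizes `f` then the coordinates of `f` are constant on the orbits of the
> subgroup … this cannot occur unless `k = 0, 3, 6`, or `9`. Thus, the orbit of `f` under `R₀` is of order `9`.")
> PROPOSITION 4.4. "(1) Suppose `R₀ = ℤ₉` and weight(`f`) `= 3`. Then the orbits of order `9` give types with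
> rank(`f`) `= 8` or `10`, and these orbits account for all but three `f`, in a single `ℤ₉`-orbit. […]
> *Proof.* (1) There are two distinct Hol(`ℤ₉`)-orbits of `ℤ₉`-orbits of order `9`, with respective ranks `8`
> and `10`. We note here that three orbits of order `9` consist of types for which rank(`f`) `= 8`."
> REMARK 4.7. "Let `A` be a simple Abelian variety with complex multiplication, and suppose that the dimension
> of `A` is `9`. Then Rank(`A`) `= 6, 8`, or `10`, and these three numbers do occur."

(`⟨ρ⟩ × ℤ₉` is the Galois group of `ℚ(ζ₁₉)`, of `ℚ(ζ₂₇)` and of every cyclic CM field of degree `18`; Serre's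
degenerate type `S = {1,3,4,5,6,7,8,10,17}` of `ℚ(ζ₁₉)` — B. B. Gordon, *A survey of the Hodge conjecture for
abelian varieties*, 9.4.2 [Gordon1999HodgeAVSurvey]; tree `Pohlmann1968/DegenerateCMTypesRibetLenstraSerre`, where
its exact rank `8` is listed as "not certified" — lies in one of the rank-`8` orbits.)  Dodson's proofs are
"explicit calculations" on orbit representatives.  This file PROVES the statements for the cyclic minimal group
`⟨ρ⟩ × ℤ_{p²}` and EVERY odd prime `p`, by the method of F. Hazama, *Hodge cycles on abelian varieties with
complex multiplication by cyclic CM-fields*, J. Math. Sci. Univ. Tokyo **10** (2003) [Hazama2003CyclicCM]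
(Prop. 4.1: the character sum of a type in coordinates; Prop. 4.3: characters of order `2q` vanish iff the
`(0,1)`-matrix of the type has constant row sums; Lemma 4.6.1: faithful characters vanish iff the type is stable
under a subgroup) — the tree's `DegenerateCMTypesCyclicTwoOddPrimes` treats Hazama's `n = pq`; here `n = p²` —
combined with T. Kubota's Lemma 2 [Kubota1965] (`rank = n + 1 −` the number of odd characters vanishing on the
type; tree `IsCMTypeWith.typeRank_add_ncard_oddCharacters_vanishing`).

## Setting and dictionary (as in `CMTypeRank.lean`, `DegenerateCMTypesCompositeDimension.lean`)

`G` is a finite commutative group acting on itself, `σ ∈ G` has order `p²`, `ρ ∉ ⟨σ⟩`, `|G| = 2p²` (Dodson's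
`⟨ρ⟩ × ℤ_{p²}`; hypotheses `hσ`, `hρσ`, `hcard` as in the Dodson 1984 file), `p` an odd prime (`[Fact p.Prime]`,
`hp2 : p ≠ 2`); `Φ : Finset G` is a CM type for `ρ` (`IsCMTypeWith ρ Φ`, which forces `ρ² = 1 ≠ ρ`); the rank is
the Kubota–Dodson `typeRank G Φ` (`= dim MT`, nondegenerate iff `= p² + 1`).  The odd part `⟨σ⟩ ≅ ℤ/p²` is written
in base `p`: `(x, y) ↦ σ^{px+y} = (σ^p)ˣ σʸ`, `x, y ∈ ℤ/p` (`coord_bijective`), so that Hazama's vocabulary of the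
`2pq`-file applies VERBATIM with `τ = σ^p`, `κ = σ`, `q = p`:
* row `y` of the `p × p` `(0,1)`-matrix of `Φ` is the coset `σʸ⟨σ^p⟩` of the subgroup of order `p`, its count is
  `rowCount p p Φ (σ^p) σ y = #{x : σ^{px+y} ∈ Φ}`, and "`Φ ∈ S_p`" is `HasConstantRows p p Φ (σ^p) σ` — for
  Dodson's `f ∈ ℤ₂⁹`: `f` has the same weight on the three cosets of `ℤ₃ ⊂ ℤ₉`;
* "`Φ ∈ S₁`" (imprimitive) is `IsStableUnder Φ (σ^p)` — Dodson: the `ℤ₉`-orbit of `f` has order `3`;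
  "primitive" is `∀ u ≠ 1, ¬ IsStableUnder Φ u` (Shimura's criterion in separation form,
  `exists_isStableUnder_iff_not_separating`) — Dodson: the orbit has order `9`;
* the character sum of `Φ` at an odd `χ` is `pairSum (signMatrix p p Φ (σ^p) σ) (χ(σ)^p) (χ(σ))`.

## What is PROVED (theorems only; no definition, no named fact, no `sorry`)

* §1 **`pairSum_pow_left_eq_zero_iff`** — the rational relations among the `p²`-th roots of unity in base `p`:
  for a primitive `p²`-th root `ω`, `Σ_{x,y} ε(x,y) ω^{px+y} = 0 ⟺ ε(x,y)` does not depend on `x` (Galois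
  averaging over `a ≡ 1 (mod p)` against `ω^{−psy₀}` projects onto a row, where `Φ_p` decides).
* §2 the frame: `pow_pow_mul_pow_injective`, **`coord_bijective`**, `exists_coord`, `orderOf_pow_eq`
  (`σ^p` has order `p`), `pow_ne_one`.
* §3 **`sum_char_eq_pairSum`** (Hazama Prop. 4.1 on `⟨ρ⟩ × ℤ_{p²}`); the three kinds of odd characters `χ`,
  `ω = χ(σ)`, `ω^{p²} = 1`: `sum_char_ne_zero_of_apply_eq_one` (`ω = 1`: never vanishes, `p²` odd);
  **`sum_char_eq_zero_iff_hasConstantRows`** (`ω^p = 1 ≠ ω`, the `p − 1` characters of order `2p`: vanish iff the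
  coset counts are constant); `forall_signMatrix_eq_iff_isStableUnder`;
  **`sum_char_eq_zero_iff_isStableUnder`** (`ω^p ≠ 1`, the `p² − p` faithful ones: vanish iff `σ^p Φ = Φ`).
* §4 **`exists_isStableUnder_iff`** (a non-trivial stabiliser exists iff `σ^p` stabilises: the subgroup of
  order `p` is the least non-trivial subgroup of `⟨σ⟩`, and `ρ⟨σ⟩` never stabilises a CM type),
  `forall_not_isStableUnder_iff` (primitive iff `σ^p Φ ≠ Φ`), `forall_mem_or_forall_not_mem` and its converse
  (stable with constant rows iff `Φ ⊇ ⟨σ⟩` or `Φ ∩ ⟨σ⟩ = ∅`: the two types `S_even`, `S_odd`).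
* §5 `sum_char_eq_zero_iff` (all odd `χ` at once), **`ncard_oddChar_vanishing_eq`**: the defect is
  `(p − 1)[rows constant] + (p² − p)[σ^p Φ = Φ]` (odd characters `↔ μ_{p²}` via `χ ↦ χ(σ)`).
* §6 THE RANKS: **`typeRank_add_defect_eq`** (`rank + defect = p² + 1`), `typeRank_eq_iff` / `typeRank_ne_iff`
  (nondegenerate iff neither condition), **`typeRank_eq_of_primitive_of_hasConstantRows`** (`(p−1)p + 2`),
  `typeRank_eq_of_primitive_of_not_hasConstantRows` (`p² + 1`), **`typeRank_eq_or_of_primitive`** = PROP. 4.4 (1)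
  for every odd `p` (a primitive type has rank `p² + 1` or `(p−1)p + 2`, the latter iff its coset counts are
  constant), `typeRank_ne_iff_of_primitive`, `typeRank_eq_of_isStableUnder_of_not_hasConstantRows` (`p + 1`),
  `typeRank_eq_two_of_isStableUnder_of_hasConstantRows` (`2`), **`typeRank_mem`** (every type has rank in
  `{p² + 1, (p−1)p + 2, p + 1, 2}`), `not_hasConstantRows_of_not_dvd` + **`typeRank_eq_of_primitive_of_not_dvd`**
  = PROP. 4.1 for `R₀ = ℤ_{p²}` with the exact rank (weight prime to `p` ⟹ `rank = p² + 1`).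
* §7 `p = 3` AS PRINTED (`σ` of order `9`, `|G| = 18`): **`typeRank_eq_or_of_primitive_nine`** ("the orbits of
  order `9` give types with rank `8` or `10`"), **`typeRank_eq_eight_iff_of_primitive_nine`** (rank `8` iff
  constant counts on the cosets of `ℤ₃` — "three orbits of order `9` consist of types for which rank(`f`) `= 8`":
  for weight `3`, one point per coset), `typeRank_eq_or_of_isStableUnder_nine` (the orbits of order `3`: ranks
  `4`, `2`), **`typeRank_mem_nine`** (Remark 4.7 on `⟨ρ⟩ × ℤ₉`: ranks `⊆ {10, 8, 4, 2}`; the value `6` of Remark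
  4.7 needs `R₀ = ℤ₃²` and a non-abelian Galois closure, Prop. 4.4 (2b)/Prop. 4.6 — NOT here).

NOT here: Prop. 4.4 (2) (`R₀ = ℤ₃ × ℤ₃`), Lemma 4.2 (Hol(`R₀`)-invariance of the rank), Remark 4.5, §4.2–4.3
(Prop. 4.6, 4.8); the COUNTS (`#S_p = Σ_a C(p,a)^p`, `#S₁ = 2^p`, the `54 = 56 − 2` primitive degenerate types
for `p = 3` = Dodson's "three orbits of order `9`" of weight `3` and their `ρ`-translates) and the number-field /
`ℚ(ζ₁₉)`, `ℚ(ζ₂₇)` dress (Serre's type has rank exactly `8`; the Hodge conjecture for all powers of the abelian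
varieties of the `p² + 1`-types) are sequels.

## References

* [Dodson1987] B. Dodson, J. Algebra 111 (1987) 49–73: §4.1 Prop. 4.1 (with proof), Lemma 4.2, Prop. 4.4 (1)
  (with proof), Remark 4.5; §4.2 Remark 4.7 (pp. 69–71).
* [Hazama2003CyclicCM] F. Hazama, J. Math. Sci. Univ. Tokyo 10 (2003) 581–598: Prop. 2.3, Prop. 4.1 and (4.1),
  Prop. 4.2, Prop. 4.3 ((4.4)–(4.5)), Prop. 4.5, Lemma 4.6.1 ((4.7)), Prop. 4.7.
* [Kubota1965] T. Kubota, Trans. AMS 118 (1965), §4 Lemma 2.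
* [Gordon1999HodgeAVSurvey] B. B. Gordon, *A survey of the Hodge conjecture for abelian varieties*, 9.4.1–9.4.2.

## Provenance

Lane `lit-hodgefound` (Track 2, Layer A3 — CM types), seat `lit-hodgefound-p10` generation 35, row g35-#1;
neighbours cited by name, nothing restated: `DegenerateCMTypesCyclicTwoOddPrimes` (`pairSum`, `signMatrix`,
`rowCount`, `HasConstantRows`, `IsStableUnder`, `sum_mul_pow_eq_zero_iff_forall_eq`, `pairSum_one_left_eq_zero_iff`),
`DegenerateCMTypesCompositeDimension` (`Dodson1984.ncard_oddChar`), `CMTypeRankCharacters` (Kubota's Lemma 2).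
-/

set_option autoImplicit false

noncomputable section

open scoped BigOperators
open Polynomial

namespace Literature.NumberTheory.ComplexMultiplication

namespace CyclicCMType

namespace PrimeSq

/-! ## §1 Rational relations among the `p²`-th roots of unity in the coordinates `b = px + y` -/

section Roots

variable {p : ℕ} [hp : Fact p.Prime]

/-- Reindex a sum over `ZMod n` by the representatives `0, …, n − 1`. [folklore] -/
private theorem sum_zmod_eq_sum_range {M : Type*} [AddCommMonoid M] {n : ℕ} [NeZero n] (f : ℕ → M) :
    ∑ k : ZMod n, f k.val = ∑ k ∈ Finset.range n, f k := by
  refine Finset.sum_nbij' (fun k => k.val) (fun k => (k : ZMod n)) ?_ ?_ ?_ ?_ ?_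
  · intro k _; exact Finset.mem_range.2 (ZMod.val_lt k)
  · intro k _; exact Finset.mem_univ _
  · intro k _; exact ZMod.natCast_zmod_val k
  · intro k hk; exact ZMod.val_cast_of_lt (Finset.mem_range.1 hk)
  · intro k _; rfl

/-- `ω^p` is a primitive `p`-th root of unity when `ω` is a primitive `p²`-th root of unity. [folklore] -/
private theorem isPrimitiveRoot_pow_of_sq {ω : ℂ} (hω : IsPrimitiveRoot ω (p ^ 2)) :
    IsPrimitiveRoot (ω ^ p) p :=
  hω.pow (pow_pos hp.out.pos 2) (sq p)

/-- `Σ_{x ∈ ℤ/p} νˣ = 0` for a primitive `p`-th root of unity `ν`. [folklore] -/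
private theorem sum_pow_val_eq_zero {ν : ℂ} (hν : IsPrimitiveRoot ν p) :
    ∑ x : ZMod p, ν ^ x.val = 0 := by
  rw [sum_zmod_eq_sum_range (fun k => ν ^ k)]
  exact hν.geom_sum_eq_zero hp.out.one_lt

/-- **Galois conjugates of a relation** `V(ε; ω^p, ω) = Σ_{x,y} ε(x,y) ω^{px+y} = 0`: the same relation holds
at `ωᵃ` for every `a` prime to `p²` (`Φ_{p²}` is the minimal polynomial of `ω` and `ωᵃ` is another of its
roots). [folklore] -/
private theorem pairSum_pow_eq_zero_of_coprime {ω : ℂ} (hω : IsPrimitiveRoot ω (p ^ 2))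
    (ε : ZMod p × ZMod p → ℤ) (h0 : pairSum ε (ω ^ p) ω = 0) {a : ℕ} (ha : a.Coprime (p ^ 2)) :
    pairSum ε ((ω ^ a) ^ p) (ω ^ a) = 0 := by
  have hn : 0 < p ^ 2 := pow_pos hp.out.pos 2
  set P : ℚ[X] := ∑ xy : ZMod p × ZMod p, C (ε xy : ℚ) * X ^ (p * xy.1.val + xy.2.val) with hP
  have hPz : ∀ z : ℂ, aeval z P = pairSum ε (z ^ p) z := by
    intro z
    simp only [hP, map_sum, map_mul, aeval_C, map_pow, aeval_X, eq_ratCast, Rat.cast_intCast]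
    unfold pairSum
    refine Finset.sum_congr rfl fun xy _ => ?_
    rw [← pow_mul, ← pow_add]
  have hdvd : minpoly ℚ ω ∣ P := minpoly.dvd ℚ ω (by rw [hPz]; exact h0)
  have hωa : IsPrimitiveRoot (ω ^ a) (p ^ 2) := hω.pow_of_coprime a ha
  have hroot : aeval (ω ^ a) (minpoly ℚ ω) = 0 := by
    rw [← cyclotomic_eq_minpoly_rat hω hn, aeval_def, ← eval_map, map_cyclotomic, ← IsRoot.def,
      isRoot_cyclotomic_iff]
    exact hωa
  have := aeval_eq_zero_of_dvd_aeval_eq_zero hdvd hroot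
  rwa [hPz] at this

/-- **Averaging the conjugates** `a = 1 + ps` against `ν^{−sy₀}` (`ν = ω^p`): a relation `V(ε; ω^p, ω) = 0`
forces `Σ_x ε(x, y₀) νˣ = 0` for every row `y₀` (Hazama's device (4.9)–(4.10), at level `p²`). [folklore] -/
private theorem sum_row_mul_pow_eq_zero {ω : ℂ} (hω : IsPrimitiveRoot ω (p ^ 2))
    (ε : ZMod p × ZMod p → ℤ) (h0 : pairSum ε (ω ^ p) ω = 0) (y₀ : ZMod p) :
    ∑ x : ZMod p, (ε (x, y₀) : ℂ) * (ω ^ p) ^ x.val = 0 := by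
  have hp0 : 0 < p := hp.out.pos
  have hν : IsPrimitiveRoot (ω ^ p) p := isPrimitiveRoot_pow_of_sq hω
  have hωn : ω ^ (p ^ 2) = 1 := hω.pow_eq_one
  have hνp : (ω ^ p) ^ p = 1 := hν.pow_eq_one
  have hω0 : ω ≠ 0 := hω.ne_zero (pow_pos hp0 2).ne'
  -- the conjugate relations, simplified: `Σ_{x,y} ε(x,y) νˣ ωʸ ν^{sy} = 0`
  have hconj : ∀ s : ℕ, ∑ xy : ZMod p × ZMod p,
      (ε xy : ℂ) * ((ω ^ p) ^ xy.1.val * (ω ^ xy.2.val * (ω ^ p) ^ (s * xy.2.val))) = 0 := by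
    intro s
    have ha : (1 + p * s).Coprime (p ^ 2) :=
      Nat.Coprime.pow_right 2 ((Nat.coprime_add_mul_left_left 1 p s).2 (Nat.coprime_one_left p))
    have h1 := pairSum_pow_eq_zero_of_coprime hω ε h0 ha
    have e1 : (ω ^ (1 + p * s)) ^ p = ω ^ p := by
      rw [← pow_mul, show (1 + p * s) * p = p + p ^ 2 * s by ring, pow_add, pow_mul, hωn, one_pow, mul_one]
    have e2 : ∀ y : ℕ, (ω ^ (1 + p * s)) ^ y = ω ^ y * (ω ^ p) ^ (s * y) := by
      intro y
      rw [← pow_mul, show (1 + p * s) * y = y + p * (s * y) by ring, pow_add, pow_mul]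
    unfold pairSum at h1
    rw [e1] at h1
    simpa only [e2] using h1
  -- the geometric sums `Σ_{s<p} θ_yˢ`, `θ_y = ν^{y + (p − y₀)}`: `p` for `y = y₀`, `0` otherwise
  have hgeom_self : ∑ s ∈ Finset.range p, ((ω ^ p) ^ (y₀.val + (p - y₀.val))) ^ s = (p : ℂ) := by
    rw [Nat.add_sub_cancel' (ZMod.val_lt y₀).le, hνp]
    simp
  have hgeom_ne : ∀ y : ZMod p, y ≠ y₀ →
      ∑ s ∈ Finset.range p, ((ω ^ p) ^ (y.val + (p - y₀.val))) ^ s = 0 := by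
    intro y hy
    have hθp : ((ω ^ p) ^ (y.val + (p - y₀.val))) ^ p = 1 := by
      rw [← pow_mul, mul_comm, pow_mul, hνp, one_pow]
    have hθ1 : (ω ^ p) ^ (y.val + (p - y₀.val)) ≠ 1 := by
      rw [Ne, hν.pow_eq_one_iff_dvd]
      intro hd
      apply hy
      have hy' := ZMod.val_lt y
      have hy₀ := ZMod.val_lt y₀
      obtain ⟨c, hc⟩ := hd
      have hc1 : c = 1 := by
        rcases Nat.lt_or_ge c 2 with hc2 | hc2
        · interval_cases c
          · omega
          · rfl
        · have : p * 2 ≤ p * c := Nat.mul_le_mul_left p hc2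
          omega
      subst hc1
      apply ZMod.val_injective p
      omega
    rw [geom_sum_eq hθ1, hθp, sub_self, zero_div]
  -- weight the `s`-th relation by `ν^{s (p − y₀)}`, sum over `s < p`, and exchange the sums
  have hsum : ∑ s ∈ Finset.range p, (ω ^ p) ^ (s * (p - y₀.val)) *
      ∑ xy : ZMod p × ZMod p,
        (ε xy : ℂ) * ((ω ^ p) ^ xy.1.val * (ω ^ xy.2.val * (ω ^ p) ^ (s * xy.2.val))) = 0 :=
    Finset.sum_eq_zero fun s _ => by rw [hconj s, mul_zero]
  have hswap : ∑ s ∈ Finset.range p, (ω ^ p) ^ (s * (p - y₀.val)) *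
      ∑ xy : ZMod p × ZMod p,
        (ε xy : ℂ) * ((ω ^ p) ^ xy.1.val * (ω ^ xy.2.val * (ω ^ p) ^ (s * xy.2.val))) =
      ∑ xy : ZMod p × ZMod p, (ε xy : ℂ) * ((ω ^ p) ^ xy.1.val * ω ^ xy.2.val) *
        ∑ s ∈ Finset.range p, ((ω ^ p) ^ (xy.2.val + (p - y₀.val))) ^ s := by
    simp_rw [Finset.mul_sum]
    rw [Finset.sum_comm]
    refine Finset.sum_congr rfl fun xy _ => ?_
    refine Finset.sum_congr rfl fun s _ => ?_
    ring
  rw [hswap, Fintype.sum_prod_type_right, Finset.sum_eq_single y₀] at hsum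
  · simp only [hgeom_self] at hsum
    have hfac : ∑ x : ZMod p, (ε (x, y₀) : ℂ) * ((ω ^ p) ^ x.val * ω ^ y₀.val) * (p : ℂ) =
        ((p : ℂ) * ω ^ y₀.val) * ∑ x : ZMod p, (ε (x, y₀) : ℂ) * (ω ^ p) ^ x.val := by
      rw [Finset.mul_sum]
      refine Finset.sum_congr rfl fun x _ => ?_
      ring
    rw [hfac, mul_eq_zero] at hsum
    rcases hsum with h | h
    · exact absurd h (mul_ne_zero (Nat.cast_ne_zero.2 hp0.ne') (pow_ne_zero _ hω0))
    · exact h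
  · intro y _ hy
    simp only [hgeom_ne y hy, mul_zero, Finset.sum_const_zero]
  · intro h; exact absurd (Finset.mem_univ _) h

/-- **The rational relations among the `p²`-th roots of unity, in the coordinates `b = px + y`**: for a primitive
`p²`-th root of unity `ω` and integers `ε(x,y)`, `V(ε; ω^p, ω) = Σ_{x,y ∈ ℤ/p} ε(x,y) ω^{px+y} = 0` iff `ε(x,y)`
does not depend on `x` — i.e. the coefficient vector `b ↦ ε` on `ℤ/p²` is constant on the cosets of `pℤ/p²ℤ`
(`Φ_{p²}(X) = Φ_p(X^p)`; the relation module is spanned by the cosets of the subgroup of order `p`).  This is the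
level-`p²` analogue of the fact used by Hazama at level `q` ("`χ(S) = 0` … (4.4) is equivalent to (4.5)").
[cite: Hazama2003CyclicCM, Prop. 4.3 (proof, (4.4)–(4.5))] -/
theorem pairSum_pow_left_eq_zero_iff {ω : ℂ} (hω : IsPrimitiveRoot ω (p ^ 2)) (ε : ZMod p × ZMod p → ℤ) :
    pairSum ε (ω ^ p) ω = 0 ↔ ∀ x x' y : ZMod p, ε (x, y) = ε (x', y) := by
  have hν : IsPrimitiveRoot (ω ^ p) p := isPrimitiveRoot_pow_of_sq hω
  constructor
  · intro h0 x x' y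
    have hrow := sum_row_mul_pow_eq_zero hω ε h0 y
    have hrow' : ∑ j : ZMod p, (((ε (j, y) : ℚ)) : ℂ) * (ω ^ p) ^ j.val = 0 := by
      simpa only [Rat.cast_intCast] using hrow
    have := (sum_mul_pow_eq_zero_iff_forall_eq hν (fun j => (ε (j, y) : ℚ))).1 hrow' x x'
    exact_mod_cast this
  · intro h
    unfold pairSum
    rw [Fintype.sum_prod_type_right]
    refine Finset.sum_eq_zero fun y _ => ?_
    have : ∑ x : ZMod p, (ε (x, y) : ℂ) * ((ω ^ p) ^ x.val * ω ^ y.val) =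
        ((ε (0, y) : ℂ) * ω ^ y.val) * ∑ x : ZMod p, (ω ^ p) ^ x.val := by
      rw [Finset.mul_sum]
      refine Finset.sum_congr rfl fun x _ => ?_
      rw [h x 0 y]
      ring
    rw [this, sum_pow_val_eq_zero hν, mul_zero]

end Roots

/-! ## §2 The group `G = ⟨ρ⟩ × ⟨σ⟩` of order `2p²` in the coordinates `(x, y) ↦ σ^{px+y}` -/

section Frame

variable {G : Type*} [CommGroup G] [Fintype G] {p : ℕ} [hp : Fact p.Prime] {ρ σ : G}

omit [Fintype G] hp in
/-- `(σ^p)ˣ σʸ = σ^{px + y}`. [folklore] -/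
private theorem pow_pow_mul_pow (x y : ℕ) : (σ ^ p) ^ x * σ ^ y = σ ^ (p * x + y) := by
  rw [← pow_mul, ← pow_add]

omit [Fintype G] hp in
/-- In `⟨ρ⟩ × ⟨σ⟩` no element `ρσⁱ` is a power of `σ`. [folklore] -/
private theorem rho_mul_pow_ne_pow (hρσ : ρ ∉ Subgroup.zpowers σ) (i j : ℕ) : ρ * σ ^ j ≠ σ ^ i := by
  intro h
  apply hρσ
  have : ρ = σ ^ i * (σ ^ j)⁻¹ := by rw [← h, mul_inv_cancel_right]
  rw [this]
  exact mul_mem (pow_mem (Subgroup.mem_zpowers σ) i) (inv_mem (pow_mem (Subgroup.mem_zpowers σ) j))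

omit [Fintype G] in
/-- **`(x, y) ↦ σ^{px+y}` is injective on `ℤ/p × ℤ/p`** for `σ` of order `p²` (`px + y < p²` determines
`x` and `y`): Dodson's regular group `ℤ₉` in base `3`. [cite: Dodson1987, §4.1 (the minimal group `⟨ρ⟩ × ℤ₉`)] -/
theorem pow_pow_mul_pow_injective (hσ : orderOf σ = p ^ 2) :
    Function.Injective fun xy : ZMod p × ZMod p => (σ ^ p) ^ xy.1.val * σ ^ xy.2.val := by
  have hp0 : 0 < p := hp.out.pos
  rintro ⟨x, y⟩ ⟨x', y'⟩ h
  have h' : σ ^ (p * x.val + y.val) = σ ^ (p * x'.val + y'.val) := by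
    simpa only [pow_pow_mul_pow] using h
  rw [pow_eq_pow_iff_modEq, hσ] at h'
  have hx := ZMod.val_lt x; have hy := ZMod.val_lt y
  have hx' := ZMod.val_lt x'; have hy' := ZMod.val_lt y'
  have hlt : ∀ a b : ℕ, a < p → b < p → p * a + b < p ^ 2 := fun a b ha hb => by
    have : p * a + b < p * a + p := by omega
    have h2 : p * a + p = p * (a + 1) := by ring
    have h3 : p * (a + 1) ≤ p * p := Nat.mul_le_mul_left p ha
    rw [sq]; omega
  have heq : p * x.val + y.val = p * x'.val + y'.val :=
    Nat.ModEq.eq_of_lt_of_lt h' (hlt _ _ hx hy) (hlt _ _ hx' hy')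
  have e2 : y.val = y'.val := by
    have := congrArg (· % p) heq
    simpa only [Nat.mul_add_mod, Nat.mod_eq_of_lt hy, Nat.mod_eq_of_lt hy'] using this
  have e1 : x.val = x'.val := by
    have := congrArg (· / p) heq
    simpa only [Nat.mul_add_div hp0, Nat.div_eq_of_lt hy, Nat.div_eq_of_lt hy', add_zero] using this
  exact Prod.ext (ZMod.val_injective p e1) (ZMod.val_injective p e2)

/-- **The coordinates of `G`**: `(x, y) ↦ σ^{px+y}` together with `(x, y) ↦ ρσ^{px+y}` is a bijection
`(ℤ/p × ℤ/p) ⊔ (ℤ/p × ℤ/p) → G` (Dodson's `G = ⟨ρ⟩ × ℤ₉`, the odd part `ℤ_{p²}` written in base `p`).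
[cite: Dodson1987, §4.1 (the minimal groups `⟨ρ⟩ × R₀`, `R₀ = ℤ₉`)] -/
theorem coord_bijective (hσ : orderOf σ = p ^ 2) (hρσ : ρ ∉ Subgroup.zpowers σ)
    (hcard : Fintype.card G = 2 * p ^ 2) :
    Function.Bijective fun s : (ZMod p × ZMod p) ⊕ (ZMod p × ZMod p) =>
      Sum.elim (fun xy => (σ ^ p) ^ xy.1.val * σ ^ xy.2.val)
        (fun xy => ρ * ((σ ^ p) ^ xy.1.val * σ ^ xy.2.val)) s := by
  rw [Fintype.bijective_iff_injective_and_card]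
  refine ⟨?_, by rw [Fintype.card_sum, Fintype.card_prod, ZMod.card, hcard, sq, two_mul]⟩
  rintro (a | a) (b | b) hab <;> simp only [Sum.elim_inl, Sum.elim_inr] at hab
  · exact congrArg Sum.inl (pow_pow_mul_pow_injective hσ hab)
  · rw [pow_pow_mul_pow, pow_pow_mul_pow] at hab
    exact absurd hab.symm (rho_mul_pow_ne_pow hρσ _ _)
  · rw [pow_pow_mul_pow, pow_pow_mul_pow] at hab
    exact absurd hab (rho_mul_pow_ne_pow hρσ _ _)
  · exact congrArg Sum.inr (pow_pow_mul_pow_injective hσ (mul_left_cancel hab))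

/-- Every `g ∈ G` is `σ^{px+y}` or `ρσ^{px+y}` with `x, y ∈ ℤ/p`. [cite: Dodson1987, §4.1] -/
theorem exists_coord (hσ : orderOf σ = p ^ 2) (hρσ : ρ ∉ Subgroup.zpowers σ)
    (hcard : Fintype.card G = 2 * p ^ 2) (g : G) :
    ∃ xy : ZMod p × ZMod p, g = (σ ^ p) ^ xy.1.val * σ ^ xy.2.val ∨
      g = ρ * ((σ ^ p) ^ xy.1.val * σ ^ xy.2.val) := by
  obtain ⟨s, h⟩ := (coord_bijective hσ hρσ hcard).2 g
  rcases s with xy | xy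
  · exact ⟨xy, Or.inl (by simpa using h.symm)⟩
  · exact ⟨xy, Or.inr (by simpa using h.symm)⟩

omit [Fintype G] in
/-- `σ^p` has order `p` (it generates the subgroup of order `p` of `⟨σ⟩ ≅ ℤ/p²` — Dodson's `ℤ₃ ⊂ ℤ₉`, whose
orbits of order `3` carry the imprimitive types). [cite: Dodson1987, Prop. 4.4 (1)] -/
theorem orderOf_pow_eq (hσ : orderOf σ = p ^ 2) : orderOf (σ ^ p) = p := by
  rw [orderOf_pow' σ hp.out.ne_zero, hσ, sq, Nat.gcd_mul_left_left, Nat.mul_div_cancel _ hp.out.pos]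

omit [Fintype G] in
/-- `σ^p ≠ 1`: the subgroup `ℤ₃ ⊂ ℤ₉` is non-trivial. [cite: Dodson1987, Prop. 4.4 (1)] -/
theorem pow_ne_one (hσ : orderOf σ = p ^ 2) : σ ^ p ≠ 1 := by
  intro h
  have := orderOf_pow_eq (p := p) hσ
  rw [h, orderOf_one] at this
  exact hp.out.one_lt.ne this

omit [Fintype G] in
/-- `(σ^p)^{(x + x').val} = (σ^p)^{x.val} (σ^p)^{x'.val}`: the exponents of `σ^p` live in `ℤ/p`. [folklore] -/
private theorem pow_pow_val_add (hσ : orderOf σ = p ^ 2) (x x' : ZMod p) :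
    (σ ^ p) ^ (x + x').val = (σ ^ p) ^ x.val * (σ ^ p) ^ x'.val := by
  have h := pow_mod_orderOf (σ ^ p) (x.val + x'.val)
  rw [orderOf_pow_eq hσ] at h
  rw [ZMod.val_add, h, pow_add]

omit [Fintype G] in
/-- `(σ^p)^{(1 : ℤ/p).val} = σ^p`. [folklore] -/
private theorem pow_pow_val_one : (σ ^ p) ^ (1 : ZMod p).val = σ ^ p := by
  haveI : Fact (1 < p) := ⟨hp.out.one_lt⟩
  rw [ZMod.val_one, pow_one]

end Frame

/-! ## §3 The character sum of a type in coordinates, and the three kinds of odd characters -/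

section CharacterSum

variable {G : Type*} [CommGroup G] [Fintype G] [DecidableEq G] {p : ℕ} [hp : Fact p.Prime] {ρ σ : G}
  {Φ : Finset G}

omit [Fintype G] [DecidableEq G] in
/-- `χ(gh) = χ(g)χ(h)`. [folklore] -/
private theorem char_mul (χ : AddChar (Additive G) ℂ) (g h : G) :
    χ (Additive.ofMul (g * h)) = χ (Additive.ofMul g) * χ (Additive.ofMul h) := by
  rw [ofMul_mul, AddChar.map_add_eq_mul]

omit [Fintype G] [DecidableEq G] in
/-- `χ(gᵉ) = χ(g)ᵉ`. [folklore] -/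
private theorem char_pow (χ : AddChar (Additive G) ℂ) (g : G) (e : ℕ) :
    χ (Additive.ofMul (g ^ e)) = χ (Additive.ofMul g) ^ e := by
  rw [ofMul_pow, AddChar.map_nsmul_eq_pow]

omit [Fintype G] [DecidableEq G] hp in
/-- `χ(σ)^{p²} = 1` for `σ` of order `p²`. [folklore] -/
private theorem char_pow_orderOf_eq_one (hσ : orderOf σ = p ^ 2) (χ : AddChar (Additive G) ℂ) :
    χ (Additive.ofMul σ) ^ (p ^ 2) = 1 := by
  rw [← char_pow, ← hσ, pow_orderOf_eq_one, ofMul_one, AddChar.map_zero_eq_one]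

omit [Fintype G] [DecidableEq G] in
/-- `ρ² = 1` for the conjugation of a CM type. [folklore] -/
private theorem rho_mul_rho (h : IsCMTypeWith ρ (Φ : Set G)) : ρ * ρ = 1 := by
  have := h.invol (1 : G)
  simpa [smul_eq_mul] using this

omit [Fintype G] [DecidableEq G] in
/-- `ρ ≠ 1` for the conjugation of a CM type. [folklore] -/
private theorem rho_ne_one (h : IsCMTypeWith ρ (Φ : Set G)) : ρ ≠ 1 := by
  intro hρ
  have := h.rho_smul_ne (1 : G)
  rw [hρ, smul_eq_mul, one_mul] at this
  exact this rfl

/-- **The character sum of a type in the coordinates `σ^{px+y}`** (Hazama's Prop. 4.1 / Kubota's character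
formula read on `⟨ρ⟩ × ℤ_{p²}`): for an ODD character `χ` and a CM type `S`,
`Σ_{s∈S} χ(s) = Σ_{x,y} E(S)(x,y) χ(σ^p)ˣ χ(σ)ʸ = V(E(S); χ(σ)^p, χ(σ))`, where `E(S)(x,y) = ±1` according as
`σ^{px+y} ∈ S` (the tree's `signMatrix p p S (σ^p) σ`). [cite: Hazama2003CyclicCM, Prop. 4.1 and (4.1)] -/
theorem sum_char_eq_pairSum (hσ : orderOf σ = p ^ 2) (hρσ : ρ ∉ Subgroup.zpowers σ)
    (hcard : Fintype.card G = 2 * p ^ 2) (h : IsCMTypeWith ρ (Φ : Set G)) (χ : AddChar (Additive G) ℂ)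
    (hχ : χ (Additive.ofMul ρ) = -1) :
    ∑ s ∈ Φ, χ (Additive.ofMul s) =
      pairSum (signMatrix p p Φ (σ ^ p) σ) (χ (Additive.ofMul σ) ^ p) (χ (Additive.ofMul σ)) := by
  set e : (ZMod p × ZMod p) ⊕ (ZMod p × ZMod p) → G := fun s =>
    Sum.elim (fun xy => (σ ^ p) ^ xy.1.val * σ ^ xy.2.val)
      (fun xy => ρ * ((σ ^ p) ^ xy.1.val * σ ^ xy.2.val)) s with he
  have hbij : Function.Bijective e := coord_bijective hσ hρσ hcard
  have h1 : ∑ s ∈ Φ, χ (Additive.ofMul s) = ∑ g : G, if g ∈ Φ then χ (Additive.ofMul g) else 0 := by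
    rw [← Finset.sum_filter, Finset.filter_mem_eq_inter, Finset.univ_inter]
  have h2 : (∑ g : G, if g ∈ Φ then χ (Additive.ofMul g) else 0) =
      ∑ s : (ZMod p × ZMod p) ⊕ (ZMod p × ZMod p), if e s ∈ Φ then χ (Additive.ofMul (e s)) else 0 :=
    (Fintype.sum_bijective e hbij (fun s => if e s ∈ Φ then χ (Additive.ofMul (e s)) else 0)
      (fun g => if g ∈ Φ then χ (Additive.ofMul g) else 0) fun _ => rfl).symm
  rw [h1, h2, Fintype.sum_sum_type]
  unfold pairSum
  rw [← Finset.sum_add_distrib]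
  refine Finset.sum_congr rfl fun xy _ => ?_
  have hval : χ (Additive.ofMul ((σ ^ p) ^ xy.1.val * σ ^ xy.2.val)) =
      (χ (Additive.ofMul σ) ^ p) ^ xy.1.val * χ (Additive.ofMul σ) ^ xy.2.val := by
    rw [char_mul, char_pow, char_pow, char_pow]
  simp only [he, Sum.elim_inl, Sum.elim_inr]
  unfold signMatrix typeSign
  by_cases hm : (σ ^ p) ^ xy.1.val * σ ^ xy.2.val ∈ Φ
  · have hm' : ρ * ((σ ^ p) ^ xy.1.val * σ ^ xy.2.val) ∉ Φ := fun h' => (rho_mul_mem_iff h _).1 h' hm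
    rw [if_neg hm', if_pos hm, if_pos hm, hval, add_zero, Int.cast_one, one_mul]
  · have hm' : ρ * ((σ ^ p) ^ xy.1.val * σ ^ xy.2.val) ∈ Φ := (rho_mul_mem_iff h _).2 hm
    rw [if_pos hm', if_neg hm, if_neg hm, char_mul, hχ, hval, zero_add]
    push_cast
    ring

/-- **The odd character of order `2` never vanishes on a type** (`χ(σ) = 1`: `χ(S) = Σ ±1` is a sum of `p²`
signs, and `p²` is odd — Hazama's Prop. 4.2 "`#(S)` is odd"). [cite: Hazama2003CyclicCM, Prop. 4.2] -/
theorem sum_char_ne_zero_of_apply_eq_one (hp2 : p ≠ 2) (hσ : orderOf σ = p ^ 2)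
    (hρσ : ρ ∉ Subgroup.zpowers σ) (hcard : Fintype.card G = 2 * p ^ 2) (h : IsCMTypeWith ρ (Φ : Set G))
    (χ : AddChar (Additive G) ℂ) (hχ : χ (Additive.ofMul ρ) = -1) (hω : χ (Additive.ofMul σ) = 1) :
    ∑ s ∈ Φ, χ (Additive.ofMul s) ≠ 0 := by
  rw [sum_char_eq_pairSum hσ hρσ hcard h χ hχ, hω, one_pow]
  unfold pairSum
  simp only [one_pow, mul_one]
  -- the sum of the `p²` signs is `2·(number of +1) − p²`, an odd integer
  have hint : ∑ xy : ZMod p × ZMod p, (signMatrix p p Φ (σ ^ p) σ xy : ℂ) =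
      ((∑ xy : ZMod p × ZMod p, signMatrix p p Φ (σ ^ p) σ xy : ℤ) : ℂ) := by push_cast; rfl
  rw [hint, Int.cast_ne_zero]
  have hrows : ∑ xy : ZMod p × ZMod p, signMatrix p p Φ (σ ^ p) σ xy =
      2 * (∑ y : ZMod p, (rowCount p p Φ (σ ^ p) σ y : ℤ)) - p * p := by
    rw [Fintype.sum_prod_type_right]
    simp_rw [sum_signMatrix_row]
    rw [Finset.sum_sub_distrib, Finset.sum_const, Finset.card_univ, ZMod.card, ← Finset.mul_sum]
    simp
  rw [hrows]
  obtain ⟨k, hk⟩ := (hp.out.odd_of_ne_two hp2).mul (hp.out.odd_of_ne_two hp2)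
  have hk' : ((p * p : ℕ) : ℤ) = 2 * k + 1 := by exact_mod_cast hk
  push_cast at hk'
  omega

/-- An element `ω ≠ 1` with `ω^p = 1` is a primitive `p`-th root of unity. [folklore] -/
private theorem isPrimitiveRoot_of_pow_eq_one {ω : ℂ} (hωp : ω ^ p = 1) (hω1 : ω ≠ 1) :
    IsPrimitiveRoot ω p :=
  IsPrimitiveRoot.iff_orderOf.2 (orderOf_eq_prime hωp hω1)

/-- **The odd characters of order `2p` (Hazama's Prop. 4.3 at level `p²`).**  For an odd `χ` with
`χ(σ)^p = 1 ≠ χ(σ)` (i.e. `χ` trivial on `⟨σ^p⟩`): `χ(S) = 0` iff `S` meets the `p` cosets `σʸ⟨σ^p⟩` of the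
subgroup of order `p` in the SAME number of points — constant row counts `#{x : σ^{px+y} ∈ S}` of the
`p × p` `(0,1)`-matrix of `S` ("there exists a natural bijection between the set `S_p` and the set of
`(0,1)`-matrices with constant row sum").  For Dodson's `f ∈ ℤ₂⁹` this says: `f` has the same weight on the three
cosets of `ℤ₃ ⊂ ℤ₉`. [cite: Hazama2003CyclicCM, Prop. 4.3] [cite: Dodson1987, Prop. 4.4 (1)] -/
theorem sum_char_eq_zero_iff_hasConstantRows (hσ : orderOf σ = p ^ 2) (hρσ : ρ ∉ Subgroup.zpowers σ)
    (hcard : Fintype.card G = 2 * p ^ 2) (h : IsCMTypeWith ρ (Φ : Set G)) (χ : AddChar (Additive G) ℂ)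
    (hχ : χ (Additive.ofMul ρ) = -1) (hωp : χ (Additive.ofMul σ) ^ p = 1) (hω1 : χ (Additive.ofMul σ) ≠ 1) :
    ∑ s ∈ Φ, χ (Additive.ofMul s) = 0 ↔ HasConstantRows p p Φ (σ ^ p) σ := by
  have hν := isPrimitiveRoot_of_pow_eq_one hωp hω1
  rw [sum_char_eq_pairSum hσ hρσ hcard h χ hχ, hωp, pairSum_one_left_eq_zero_iff hν]
  exact forall_sum_signMatrix_row_eq_iff p p Φ (σ ^ p) σ

/-- **`E(S)` constant down the columns ⟺ `S` is `σ^p`-stable** (`σ^p · σ^{px+y} = σ^{p(x+1)+y}`: the matrix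
entry `(x, y)` moves to `(x + 1, y)`; the dictionary (4.7) between "`E(S)` stable under `ℤ/pℤ`" and "`S` stable
under the subgroup of order `p`"). [cite: Hazama2003CyclicCM, Lemma 4.6.1 ((4.7))] -/
theorem forall_signMatrix_eq_iff_isStableUnder (hσ : orderOf σ = p ^ 2) (hρσ : ρ ∉ Subgroup.zpowers σ)
    (hcard : Fintype.card G = 2 * p ^ 2) (h : IsCMTypeWith ρ (Φ : Set G)) :
    (∀ (x x' y : ZMod p), signMatrix p p Φ (σ ^ p) σ (x, y) = signMatrix p p Φ (σ ^ p) σ (x', y)) ↔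
      IsStableUnder Φ (σ ^ p) := by
  have hstep : ∀ (x y : ZMod p),
      σ ^ p * ((σ ^ p) ^ x.val * σ ^ y.val) = (σ ^ p) ^ (x + 1).val * σ ^ y.val := fun x y => by
    rw [pow_pow_val_add hσ, pow_pow_val_one, ← mul_assoc, mul_comm (σ ^ p) ((σ ^ p) ^ x.val)]
  constructor
  · intro H s
    obtain ⟨xy, rfl | rfl⟩ := exists_coord hσ hρσ hcard s
    · rw [hstep, ← typeSign_eq_typeSign_iff]
      exact H xy.1 (xy.1 + 1) xy.2
    · rw [mul_left_comm (σ ^ p) ρ ((σ ^ p) ^ xy.1.val * σ ^ xy.2.val), hstep, rho_mul_mem_iff h,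
        rho_mul_mem_iff h, not_iff_not, ← typeSign_eq_typeSign_iff]
      exact H xy.1 (xy.1 + 1) xy.2
  · intro H
    have h1 : ∀ (x y : ZMod p),
        signMatrix p p Φ (σ ^ p) σ (x + 1, y) = signMatrix p p Φ (σ ^ p) σ (x, y) := by
      intro x y
      unfold signMatrix
      rw [typeSign_eq_typeSign_iff]
      simp only
      rw [← hstep]
      exact (H _).symm
    have h2 : ∀ (k : ℕ) (x y : ZMod p),
        signMatrix p p Φ (σ ^ p) σ (x + k, y) = signMatrix p p Φ (σ ^ p) σ (x, y) := by
      intro k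
      induction k with
      | zero => intro x y; rw [Nat.cast_zero, add_zero]
      | succ k ih => intro x y; rw [Nat.cast_succ, ← add_assoc, h1, ih]
    intro x x' y
    have hx' : x' = x + ((x' - x).val : ZMod p) := by rw [ZMod.natCast_zmod_val, add_sub_cancel]
    rw [hx', h2]

/-- An element `ω` with `ω^{p²} = 1 ≠ ω^p` is a primitive `p²`-th root of unity. [folklore] -/
private theorem isPrimitiveRoot_sq_of_pow_ne_one {ω : ℂ} (hωn : ω ^ (p ^ 2) = 1) (hωp : ω ^ p ≠ 1) :
    IsPrimitiveRoot ω (p ^ 2) := by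
  rw [IsPrimitiveRoot.iff_orderOf]
  exact orderOf_eq_prime_pow (n := 1) (by rwa [pow_one]) hωn

/-- **The faithful odd characters (order `2p²`).**  For an odd `χ` with `χ(σ)^p ≠ 1`: `χ(S) = 0` iff `S` is
stable under `σ^p`, i.e. under the subgroup of order `p` (the rational relations among the `p²`-th roots of
unity are spanned by the cosets of that subgroup, `pairSum_pow_left_eq_zero_iff`) — Hazama's Lemma 4.6.1
"`S ∈ S₁` iff `S` is stable under `ℤ/2pℤ`" at level `p²`; for Dodson: `f` is constant on the cosets of `ℤ₃`,
the `ℤ₉`-orbit of `f` has order `3`. [cite: Hazama2003CyclicCM, Lemma 4.6.1] [cite: Dodson1987, Prop. 4.4 (1)] -/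
theorem sum_char_eq_zero_iff_isStableUnder (hσ : orderOf σ = p ^ 2) (hρσ : ρ ∉ Subgroup.zpowers σ)
    (hcard : Fintype.card G = 2 * p ^ 2) (h : IsCMTypeWith ρ (Φ : Set G)) (χ : AddChar (Additive G) ℂ)
    (hχ : χ (Additive.ofMul ρ) = -1) (hωp : χ (Additive.ofMul σ) ^ p ≠ 1) :
    ∑ s ∈ Φ, χ (Additive.ofMul s) = 0 ↔ IsStableUnder Φ (σ ^ p) := by
  have hω := isPrimitiveRoot_sq_of_pow_ne_one (char_pow_orderOf_eq_one hσ χ) hωp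
  rw [sum_char_eq_pairSum hσ hρσ hcard h χ hχ, pairSum_pow_left_eq_zero_iff hω,
    forall_signMatrix_eq_iff_isStableUnder hσ hρσ hcard h]

end CharacterSum

/-! ## §4 Stabilisers: the subgroup of order `p` is the only possible one (Prop. 2.3 on `⟨ρ⟩ × ℤ_{p²}`) -/

section Stabilisers

variable {G : Type*} [CommGroup G] [Fintype G] [DecidableEq G] {p : ℕ} [hp : Fact p.Prime] {ρ σ : G}
  {Φ : Finset G}

omit [DecidableEq G] in
/-- **A non-trivial stabiliser contains `σ^p`** (`p` odd).  Some `u ≠ 1` stabilises the CM type `S` iff `σ^p`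
does: the stabiliser avoids `ρ⟨σ⟩` (a stabilising `ρσⁱ` would give the stabilising `(ρσⁱ)^{p²} = ρ`, absurd for
a CM type) and every non-trivial subgroup of `⟨σ⟩ ≅ ℤ/p²` contains `⟨σ^p⟩` — Dodson: "if a subgroup of `R₀`
stabilizes `f` then the coordinates of `f` are constant on the orbits of the subgroup"; the `ℤ₉`-orbit of `f` has
order `9` or `3`. [cite: Dodson1987, Prop. 4.1 (proof) and Prop. 4.4 (1)] [cite: Hazama2003CyclicCM, Prop. 2.3] -/
theorem exists_isStableUnder_iff (hp2 : p ≠ 2) (hσ : orderOf σ = p ^ 2) (hρσ : ρ ∉ Subgroup.zpowers σ)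
    (hcard : Fintype.card G = 2 * p ^ 2) (h : IsCMTypeWith ρ (Φ : Set G)) :
    (∃ u : G, u ≠ 1 ∧ IsStableUnder Φ u) ↔ IsStableUnder Φ (σ ^ p) := by
  constructor
  · rintro ⟨u, hu1, hu⟩
    obtain ⟨⟨x, y⟩, rfl | rfl⟩ := exists_coord hσ hρσ hcard u
    · -- `u = σ^{px+y} ≠ 1`
      simp only at hu1 hu ⊢
      rw [pow_pow_mul_pow] at hu1 hu
      by_cases hy : y = 0
      · -- `u = (σ^p)^x` with `x ≢ 0`: a suitable power of `u` is `σ^p`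
        subst hy
        have hx : x.val ≠ 0 := by
          intro hx
          apply hu1
          rw [hx, ZMod.val_zero, mul_zero, add_zero, pow_zero]
        rw [ZMod.val_zero, add_zero, pow_mul] at hu
        have hcop : x.val.Coprime (orderOf (σ ^ p)) := by
          rw [orderOf_pow_eq hσ]
          exact (Nat.coprime_of_lt_prime hx (ZMod.val_lt x) hp.out).symm
        obtain ⟨m, hm⟩ := exists_pow_eq_self_of_coprime hcop
        exact hm ▸ hu.pow m
      · -- `u = σ^{px+y}` with `p ∤ px + y`: a power of `u` is `σ`, hence one is `σ^p`
        have hy' : y.val ≠ 0 := by rwa [Ne, ZMod.val_eq_zero]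
        have hnd : ¬ p ∣ p * x.val + y.val := by
          intro hd
          have : p ∣ y.val := (Nat.dvd_add_right (Dvd.intro _ rfl)).1 hd
          exact hy' (Nat.eq_zero_of_dvd_of_lt this (ZMod.val_lt y))
        have hcop : (p * x.val + y.val).Coprime (orderOf σ) := by
          rw [hσ]
          refine Nat.Coprime.pow_right 2 ?_
          rw [Nat.coprime_comm, Nat.Prime.coprime_iff_not_dvd hp.out]
          exact hnd
        obtain ⟨m, hm⟩ := exists_pow_eq_self_of_coprime hcop
        have := (hu.pow m).pow p
        rwa [hm] at this
    · -- `u = ρσ^{px+y}`: then `u^{p²} = ρ` would stabilise `S`, impossible for a CM type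
      exfalso
      have hpq := hu.pow (p ^ 2)
      obtain ⟨k, hk⟩ : Odd (p ^ 2) := (hp.out.odd_of_ne_two hp2).pow
      have hρpow : ρ ^ (p ^ 2) = ρ := by
        rw [hk, pow_succ, pow_mul, sq ρ, rho_mul_rho h, one_pow, one_mul]
      have hgpow : ((σ ^ p) ^ x.val * σ ^ y.val) ^ (p ^ 2) = 1 := by
        rw [pow_pow_mul_pow, ← pow_mul, mul_comm, pow_mul, ← hσ, pow_orderOf_eq_one, one_pow]
      rw [mul_pow, hρpow, hgpow, mul_one] at hpq
      have h1 := hpq 1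
      rw [mul_one] at h1
      have h2 := rho_mul_mem_iff h 1
      rw [mul_one] at h2
      exact iff_not_self (h1.trans h2)
  · intro H
    exact ⟨σ ^ p, pow_ne_one hσ, H⟩

omit [DecidableEq G] in
/-- **Primitivity read on `σ^p`**: the CM type `S` is primitive (no `u ≠ 1` stabilises it — Shimura's
criterion in the tree's separation form, `exists_isStableUnder_iff_not_separating`) iff `σ^p S ≠ S`, i.e. iff
`S` is NOT induced from the index-`p` subgroup: Dodson's "the orbit of `f` under `R₀` is of order `9`".
[cite: Dodson1987, Prop. 4.1 (proof)] -/
theorem forall_not_isStableUnder_iff (hp2 : p ≠ 2) (hσ : orderOf σ = p ^ 2) (hρσ : ρ ∉ Subgroup.zpowers σ)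
    (hcard : Fintype.card G = 2 * p ^ 2) (h : IsCMTypeWith ρ (Φ : Set G)) :
    (∀ u : G, u ≠ 1 → ¬ IsStableUnder Φ u) ↔ ¬ IsStableUnder Φ (σ ^ p) := by
  rw [← exists_isStableUnder_iff hp2 hσ hρσ hcard h]
  simp only [not_exists, not_and]

/-- **`σ^p`-stable with constant row counts forces `S ⊇ ⟨σ⟩` or `S ∩ ⟨σ⟩ = ∅`** (the two types `S_even`,
`S_odd` induced from the index-`p²` subgroup: under `σ^p`-stability every row `σʸ⟨σ^p⟩` lies in `S` entirely
or not at all, and constant counts make all rows alike — Hazama's Prop. 4.5/4.7 at level `p²`; Dodson's orbit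
`{0, ρ}`). [cite: Hazama2003CyclicCM, Prop. 4.5 and Prop. 4.7] -/
theorem forall_mem_or_forall_not_mem (hσ : orderOf σ = p ^ 2) (hρσ : ρ ∉ Subgroup.zpowers σ)
    (hcard : Fintype.card G = 2 * p ^ 2) (h : IsCMTypeWith ρ (Φ : Set G)) (hs : IsStableUnder Φ (σ ^ p))
    (hr : HasConstantRows p p Φ (σ ^ p) σ) :
    (∀ xy : ZMod p × ZMod p, (σ ^ p) ^ xy.1.val * σ ^ xy.2.val ∈ Φ) ∨
      (∀ xy : ZMod p × ZMod p, (σ ^ p) ^ xy.1.val * σ ^ xy.2.val ∉ Φ) := by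
  have Hx := (forall_signMatrix_eq_iff_isStableUnder hσ hρσ hcard h).2 hs
  -- every row is full or empty, according to its entry in column `0`
  have hcount : ∀ z : ZMod p, rowCount p p Φ (σ ^ p) σ z =
      if signMatrix p p Φ (σ ^ p) σ (0, z) = 1 then p else 0 := by
    intro z
    rw [rowCount_eq_card_filter_signMatrix]
    split_ifs with hz
    · rw [Finset.filter_true_of_mem fun x _ => by rw [Hx x 0 z, hz], Finset.card_univ, ZMod.card]
    · rw [Finset.card_eq_zero, Finset.filter_eq_empty_iff]
      intro x _; rw [Hx x 0 z]; exact hz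
  have hp0 : p ≠ 0 := hp.out.ne_zero
  -- constant counts: all rows have the sign of row `0`
  have key : ∀ xy : ZMod p × ZMod p,
      signMatrix p p Φ (σ ^ p) σ xy = signMatrix p p Φ (σ ^ p) σ (0, 0) := by
    rintro ⟨x, y⟩
    rw [Hx x 0 y]
    have hyy := hr y 0
    rw [hcount, hcount] at hyy
    rcases signMatrix_eq_or p p Φ (σ ^ p) σ (0, y) with e | e <;>
      rcases signMatrix_eq_or p p Φ (σ ^ p) σ (0, 0) with e' | e'
    · rw [e, e']
    · exfalso
      rw [if_pos e, if_neg (by rw [e']; norm_num)] at hyy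
      exact hp0 hyy
    · exfalso
      rw [if_neg (by rw [e]; norm_num), if_pos e'] at hyy
      exact hp0 hyy.symm
    · rw [e, e']
  rcases signMatrix_eq_or p p Φ (σ ^ p) σ (0, 0) with e0 | e0
  · left
    intro xy
    rw [← signMatrix_eq_one_iff p p Φ (σ ^ p) σ xy, key xy, e0]
  · right
    intro xy hmem
    rw [← signMatrix_eq_one_iff p p Φ (σ ^ p) σ xy, key xy, e0] at hmem
    norm_num at hmem

/-- Conversely, if `S` contains the whole odd part `{σ^{px+y}}` or none of it, then `S` is `σ^p`-stable and
has constant row counts. [cite: Hazama2003CyclicCM, Prop. 4.5] -/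
theorem isStableUnder_and_hasConstantRows_of_forall (hσ : orderOf σ = p ^ 2)
    (hρσ : ρ ∉ Subgroup.zpowers σ) (hcard : Fintype.card G = 2 * p ^ 2) (h : IsCMTypeWith ρ (Φ : Set G))
    (H : (∀ xy : ZMod p × ZMod p, (σ ^ p) ^ xy.1.val * σ ^ xy.2.val ∈ Φ) ∨
      (∀ xy : ZMod p × ZMod p, (σ ^ p) ^ xy.1.val * σ ^ xy.2.val ∉ Φ)) :
    IsStableUnder Φ (σ ^ p) ∧ HasConstantRows p p Φ (σ ^ p) σ := by
  have key : ∀ xy xy' : ZMod p × ZMod p,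
      signMatrix p p Φ (σ ^ p) σ xy = signMatrix p p Φ (σ ^ p) σ xy' := by
    intro xy xy'
    unfold signMatrix
    rw [typeSign_eq_typeSign_iff]
    rcases H with H | H
    · exact iff_of_true (H xy) (H xy')
    · exact iff_of_false (H xy) (H xy')
  refine ⟨(forall_signMatrix_eq_iff_isStableUnder hσ hρσ hcard h).1 fun x x' y => key _ _, fun y y' => ?_⟩
  rw [rowCount_eq_card_filter_signMatrix, rowCount_eq_card_filter_signMatrix]
  congr 1
  exact Finset.filter_congr fun x _ => by rw [key (x, y) (x, y')]

end Stabilisers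

/-! ## §5 Counting the vanishing odd characters (Kubota's defect) -/

section Defect

variable {G : Type*} [CommGroup G] [Fintype G] [DecidableEq G] {p : ℕ} [hp : Fact p.Prime] {ρ σ : G}
  {Φ : Finset G}

open Dodson1984 (ncard_oddChar)

omit [DecidableEq G] in
/-- **An odd character of `⟨ρ⟩ × ⟨σ⟩` is determined by its value at `σ`.** [folklore] -/
private theorem oddChar_injOn (hσ : orderOf σ = p ^ 2) (hρσ : ρ ∉ Subgroup.zpowers σ)
    (hcard : Fintype.card G = 2 * p ^ 2) :
    Set.InjOn (fun χ : AddChar (Additive G) ℂ => χ (Additive.ofMul σ))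
      {χ : AddChar (Additive G) ℂ | χ (Additive.ofMul ρ) = -1} := by
  intro χ₁ h₁ χ₂ h₂ heq
  simp only [Set.mem_setOf_eq] at h₁ h₂ heq
  refine DFunLike.ext _ _ fun a => ?_
  obtain ⟨⟨x, y⟩, hx | hx⟩ := exists_coord hσ hρσ hcard (Additive.toMul a)
  · have : a = Additive.ofMul (σ ^ (p * x.val + y.val)) := by rw [← pow_pow_mul_pow, ← hx]; rfl
    rw [this, char_pow, char_pow, heq]
  · have : a = Additive.ofMul (ρ * σ ^ (p * x.val + y.val)) := by rw [← pow_pow_mul_pow, ← hx]; rfl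
    rw [this, char_mul, char_mul, char_pow, char_pow, h₁, h₂, heq]

/-- The `m`-th roots of unity in `ℂ` as a set are the finset `nthRootsFinset m 1`. [folklore] -/
private theorem setOf_pow_eq_one_eq_coe_nthRootsFinset {m : ℕ} (hm : 0 < m) :
    {ω : ℂ | ω ^ m = 1} = ↑(Polynomial.nthRootsFinset m (1 : ℂ)) := by
  ext ω
  rw [Set.mem_setOf_eq, Finset.mem_coe, Polynomial.mem_nthRootsFinset hm]

/-- `#{ω ∈ ℂ : ωᵐ = 1} = m` (`m ≥ 1`). [folklore] -/
private theorem ncard_setOf_pow_eq_one {m : ℕ} (hm : 0 < m) : {ω : ℂ | ω ^ m = 1}.ncard = m := by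
  rw [setOf_pow_eq_one_eq_coe_nthRootsFinset hm, Set.ncard_coe_finset,
    (Complex.isPrimitiveRoot_exp m hm.ne').card_nthRootsFinset]

omit [DecidableEq G] in
/-- **`χ ↦ χ(σ)` maps the odd characters ONTO the `p²`-th roots of unity** (injective; both sets have `p²`
elements). [folklore] -/
private theorem image_oddChar_eq (hσ : orderOf σ = p ^ 2) (hρσ : ρ ∉ Subgroup.zpowers σ)
    (hcard : Fintype.card G = 2 * p ^ 2) (hρ1 : ρ ≠ 1) (hρ2 : ρ * ρ = 1) :
    (fun χ : AddChar (Additive G) ℂ => χ (Additive.ofMul σ)) ''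
        {χ : AddChar (Additive G) ℂ | χ (Additive.ofMul ρ) = -1} = {ω : ℂ | ω ^ (p ^ 2) = 1} := by
  have hn : 0 < p ^ 2 := pow_pos hp.out.pos 2
  apply Set.eq_of_subset_of_ncard_le
  · rintro _ ⟨χ, -, rfl⟩
    exact char_pow_orderOf_eq_one hσ χ
  · rw [(oddChar_injOn hσ hρσ hcard).ncard_image, ncard_oddChar hρ1 hρ2 hcard, ncard_setOf_pow_eq_one hn]
  · rw [setOf_pow_eq_one_eq_coe_nthRootsFinset hn]
    exact Finset.finite_toSet _

/-- `#{ω : ω^p = 1, ω ≠ 1} = p − 1`. [folklore] -/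
private theorem ncard_setOf_pow_eq_one_ne_one :
    {ω : ℂ | ω ^ p = 1 ∧ ω ≠ 1}.ncard = p - 1 := by
  have hset : {ω : ℂ | ω ^ p = 1 ∧ ω ≠ 1} = {ω : ℂ | ω ^ p = 1} \ {1} := by
    ext ω
    simp only [Set.mem_setOf_eq, Set.mem_sdiff, Set.mem_singleton_iff]
  rw [hset, Set.ncard_sdiff_singleton_of_mem (by simp : (1 : ℂ) ∈ {ω : ℂ | ω ^ p = 1}),
    ncard_setOf_pow_eq_one hp.out.pos]

/-- `#{ω : ω^{p²} = 1, ω^p ≠ 1} = p² − p` (the primitive `p²`-th roots of unity). [folklore] -/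
private theorem ncard_setOf_pow_sq_eq_one_pow_ne_one :
    {ω : ℂ | ω ^ (p ^ 2) = 1 ∧ ω ^ p ≠ 1}.ncard = p ^ 2 - p := by
  have hsub : {ω : ℂ | ω ^ p = 1} ⊆ {ω : ℂ | ω ^ (p ^ 2) = 1} := by
    intro ω hω
    simp only [Set.mem_setOf_eq] at hω ⊢
    rw [sq, pow_mul, hω, one_pow]
  have hset : {ω : ℂ | ω ^ (p ^ 2) = 1 ∧ ω ^ p ≠ 1} = {ω : ℂ | ω ^ (p ^ 2) = 1} \ {ω : ℂ | ω ^ p = 1} := by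
    ext ω
    simp only [Set.mem_setOf_eq, Set.mem_sdiff]
  have hfin : {ω : ℂ | ω ^ (p ^ 2) = 1}.Finite := by
    rw [setOf_pow_eq_one_eq_coe_nthRootsFinset (pow_pos hp.out.pos 2)]
    exact Finset.finite_toSet _
  rw [hset, Set.ncard_sdiff hsub (hfin.subset hsub), ncard_setOf_pow_eq_one (pow_pos hp.out.pos 2),
    ncard_setOf_pow_eq_one hp.out.pos]

/-- **The vanishing criterion for an arbitrary odd character**, the three kinds together (`p` odd): `χ(S) = 0`
iff (`χ(σ)^p = 1 ≠ χ(σ)` and the rows are constant) or (`χ(σ)^p ≠ 1` and `σ^p S = S`).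
[cite: Kubota1965, §4 Lemma 2] [cite: Dodson1987, Prop. 4.4 (1)] -/
theorem sum_char_eq_zero_iff (hp2 : p ≠ 2) (hσ : orderOf σ = p ^ 2) (hρσ : ρ ∉ Subgroup.zpowers σ)
    (hcard : Fintype.card G = 2 * p ^ 2) (h : IsCMTypeWith ρ (Φ : Set G)) (χ : AddChar (Additive G) ℂ)
    (hχ : χ (Additive.ofMul ρ) = -1) :
    ∑ s ∈ Φ, χ (Additive.ofMul s) = 0 ↔
      (χ (Additive.ofMul σ) ^ p = 1 ∧ χ (Additive.ofMul σ) ≠ 1 ∧ HasConstantRows p p Φ (σ ^ p) σ) ∨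
        (χ (Additive.ofMul σ) ^ p ≠ 1 ∧ IsStableUnder Φ (σ ^ p)) := by
  by_cases hωp : χ (Additive.ofMul σ) ^ p = 1
  · by_cases hω1 : χ (Additive.ofMul σ) = 1
    · have hne := sum_char_ne_zero_of_apply_eq_one hp2 hσ hρσ hcard h χ hχ hω1
      simp only [hne, hω1, ne_eq, not_true_eq_false, false_and, and_false, one_pow, false_or]
    · rw [sum_char_eq_zero_iff_hasConstantRows hσ hρσ hcard h χ hχ hωp hω1]
      simp only [hωp, ne_eq, hω1, not_false_eq_true, true_and, not_true_eq_false, false_and, or_false]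
  · rw [sum_char_eq_zero_iff_isStableUnder hσ hρσ hcard h χ hχ hωp]
    simp only [hωp, false_and, false_or, ne_eq, not_false_eq_true, true_and]

open scoped Classical in
/-- **The number of odd characters vanishing on `S`** (Kubota's defect of `S`): the `p − 1` characters of order
`2p` if the rows are constant, plus the `p² − p` faithful ones if `S` is `σ^p`-stable.
[cite: Kubota1965, §4 Lemma 2] [cite: Dodson1987, Prop. 4.4 (1)] -/
theorem ncard_oddChar_vanishing_eq (hp2 : p ≠ 2) (hσ : orderOf σ = p ^ 2) (hρσ : ρ ∉ Subgroup.zpowers σ)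
    (hcard : Fintype.card G = 2 * p ^ 2) (h : IsCMTypeWith ρ (Φ : Set G)) :
    {χ : AddChar (Additive G) ℂ | χ (Additive.ofMul ρ) = -1 ∧ ∑ s ∈ Φ, χ (Additive.ofMul s) = 0}.ncard =
      (if HasConstantRows p p Φ (σ ^ p) σ then p - 1 else 0) +
        (if IsStableUnder Φ (σ ^ p) then p ^ 2 - p else 0) := by
  set Rows := HasConstantRows p p Φ (σ ^ p) σ with hRows
  set Stab := IsStableUnder Φ (σ ^ p) with hStab
  set ev : AddChar (Additive G) ℂ → ℂ := fun χ => χ (Additive.ofMul σ) with hev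
  set A : Set ℂ := {ω | ω ^ p = 1 ∧ ω ≠ 1 ∧ Rows} with hA
  set B : Set ℂ := {ω | ω ^ (p ^ 2) = 1 ∧ ω ^ p ≠ 1 ∧ Stab} with hB
  -- the vanishing odd characters are the odd characters with `χ(σ) ∈ A ∪ B`
  have hV : {χ : AddChar (Additive G) ℂ | χ (Additive.ofMul ρ) = -1 ∧ ∑ s ∈ Φ, χ (Additive.ofMul s) = 0} =
      {χ : AddChar (Additive G) ℂ | χ (Additive.ofMul ρ) = -1} ∩ ev ⁻¹' (A ∪ B) := by
    ext χ
    simp only [Set.mem_setOf_eq, Set.mem_inter_iff, Set.mem_preimage, Set.mem_union, hev, hA, hB]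
    refine ⟨fun ⟨hχ, h0⟩ => ⟨hχ, ?_⟩, fun ⟨hχ, hAB⟩ => ⟨hχ, ?_⟩⟩
    · rcases (sum_char_eq_zero_iff hp2 hσ hρσ hcard h χ hχ).1 h0 with ⟨h1, h2, h3⟩ | ⟨h1, h2⟩
      · exact Or.inl ⟨h1, h2, h3⟩
      · exact Or.inr ⟨char_pow_orderOf_eq_one hσ χ, h1, h2⟩
    · rw [sum_char_eq_zero_iff hp2 hσ hρσ hcard h χ hχ]
      rcases hAB with ⟨h1, h2, h3⟩ | ⟨-, h1, h2⟩
      · exact Or.inl ⟨h1, h2, h3⟩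
      · exact Or.inr ⟨h1, h2⟩
  have hinj : Set.InjOn ev ({χ : AddChar (Additive G) ℂ | χ (Additive.ofMul ρ) = -1} ∩ ev ⁻¹' (A ∪ B)) :=
    (oddChar_injOn hσ hρσ hcard).mono Set.inter_subset_left
  rw [hV, ← hinj.ncard_image, Set.image_inter_preimage, hev,
    image_oddChar_eq hσ hρσ hcard (rho_ne_one h) (rho_mul_rho h)]
  -- `μ_{p²} ∩ (A ∪ B) = A ∪ B`, a disjoint union
  have hAsub : A ⊆ {ω : ℂ | ω ^ (p ^ 2) = 1} := by
    rintro ω ⟨hω, -, -⟩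
    simp only [Set.mem_setOf_eq]
    rw [sq, pow_mul, hω, one_pow]
  have hBsub : B ⊆ {ω : ℂ | ω ^ (p ^ 2) = 1} := fun ω hω => hω.1
  have hinter : {ω : ℂ | ω ^ (p ^ 2) = 1} ∩ (A ∪ B) = A ∪ B :=
    Set.inter_eq_right.2 (Set.union_subset hAsub hBsub)
  have hdisj : Disjoint A B := by
    rw [Set.disjoint_left]
    rintro ω ⟨hω, -, -⟩ ⟨-, hω', -⟩
    exact hω' hω
  have hfin : {ω : ℂ | ω ^ (p ^ 2) = 1}.Finite := by
    rw [setOf_pow_eq_one_eq_coe_nthRootsFinset (pow_pos hp.out.pos 2)]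
    exact Finset.finite_toSet _
  rw [hinter, Set.ncard_union_eq hdisj (hfin.subset hAsub) (hfin.subset hBsub)]
  -- count `A` and `B`
  have hAc : A.ncard = if Rows then p - 1 else 0 := by
    split_ifs with hr
    · have : A = {ω : ℂ | ω ^ p = 1 ∧ ω ≠ 1} := by
        ext ω; simp only [hA, Set.mem_setOf_eq, hr, and_true]
      rw [this, ncard_setOf_pow_eq_one_ne_one]
    · have : A = ∅ := by
        ext ω; simp only [hA, Set.mem_setOf_eq, hr, and_false, Set.mem_empty_iff_false]
      rw [this, Set.ncard_empty]
  have hBc : B.ncard = if Stab then p ^ 2 - p else 0 := by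
    split_ifs with hs
    · have : B = {ω : ℂ | ω ^ (p ^ 2) = 1 ∧ ω ^ p ≠ 1} := by
        ext ω; simp only [hB, Set.mem_setOf_eq, hs, and_true]
      rw [this, ncard_setOf_pow_sq_eq_one_pow_ne_one]
    · have : B = ∅ := by
        ext ω; simp only [hB, Set.mem_setOf_eq, hs, and_false, Set.mem_empty_iff_false]
      rw [this, Set.ncard_empty]
  rw [hAc, hBc]

end Defect

/-! ## §6 The rank of every CM type of the cyclic group of order `2p²` (Dodson 1987, Prop. 4.4 (1)) -/

section Rank

variable {G : Type*} [CommGroup G] [Fintype G] [DecidableEq G] {p : ℕ} [hp : Fact p.Prime] {ρ σ : G}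
  {Φ : Finset G}

open Dodson1984 (ncard_oddChar)

open scoped Classical in
/-- **Rank plus defect** (Kubota's `rank = p² + 1 − defect`, the defect counted in §5):
`rank(S) + (p − 1)[rows constant] + (p² − p)[σ^p S = S] = p² + 1`.
[cite: Kubota1965, §4 Lemma 2] [cite: Dodson1987, Prop. 4.4 (1)] -/
theorem typeRank_add_defect_eq (hp2 : p ≠ 2) (hσ : orderOf σ = p ^ 2) (hρσ : ρ ∉ Subgroup.zpowers σ)
    (hcard : Fintype.card G = 2 * p ^ 2) (h : IsCMTypeWith ρ (Φ : Set G)) :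
    typeRank G (Φ : Set G) +
        ((if HasConstantRows p p Φ (σ ^ p) σ then p - 1 else 0) +
          (if IsStableUnder Φ (σ ^ p) then p ^ 2 - p else 0)) = p ^ 2 + 1 := by
  have hdef := h.typeRank_add_ncard_oddCharacters_vanishing
  rw [ncard_oddChar_vanishing_eq hp2 hσ hρσ hcard h, ncard_oddChar (rho_ne_one h) (rho_mul_rho h) hcard]
    at hdef
  convert hdef using 2

/-- **Nondegeneracy criterion**: `rank(S) = p² + 1` iff the rows of `S` are NOT constant and `σ^p S ≠ S`.
[cite: Dodson1987, Prop. 4.4 (1)] [cite: Kubota1965, §4 Lemma 2] -/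
theorem typeRank_eq_iff (hp2 : p ≠ 2) (hσ : orderOf σ = p ^ 2) (hρσ : ρ ∉ Subgroup.zpowers σ)
    (hcard : Fintype.card G = 2 * p ^ 2) (h : IsCMTypeWith ρ (Φ : Set G)) :
    typeRank G (Φ : Set G) = p ^ 2 + 1 ↔
      ¬ HasConstantRows p p Φ (σ ^ p) σ ∧ ¬ IsStableUnder Φ (σ ^ p) := by
  classical
  have key := typeRank_add_defect_eq hp2 hσ hρσ hcard h
  have hp1 : 1 < p := hp.out.one_lt
  have hpp : p < p ^ 2 := by rw [sq]; exact lt_mul_self hp1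
  constructor
  · intro hrk
    refine ⟨fun hr => ?_, fun hs => ?_⟩
    · rw [if_pos hr] at key
      omega
    · rw [if_pos hs] at key
      omega
  · rintro ⟨hr, hs⟩
    rw [if_neg hr, if_neg hs] at key
    omega

/-- **Degeneracy criterion**: `rank(S) ≠ p² + 1` iff the rows are constant or `σ^p S = S`.
[cite: Dodson1987, Prop. 4.4 (1)] -/
theorem typeRank_ne_iff (hp2 : p ≠ 2) (hσ : orderOf σ = p ^ 2) (hρσ : ρ ∉ Subgroup.zpowers σ)
    (hcard : Fintype.card G = 2 * p ^ 2) (h : IsCMTypeWith ρ (Φ : Set G)) :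
    typeRank G (Φ : Set G) ≠ p ^ 2 + 1 ↔ HasConstantRows p p Φ (σ ^ p) σ ∨ IsStableUnder Φ (σ ^ p) := by
  rw [Ne, typeRank_eq_iff hp2 hσ hρσ hcard h, not_and_or, not_not, not_not]

/-- **The rank of a PRIMITIVE type with constant rows is `p² − p + 2 = (p − 1)p + 2`** (the `p − 1` odd
characters of order `2p` are exactly the vanishing ones): Dodson's orbits of order `9` with `rank(f) = 8`.
[cite: Dodson1987, Prop. 4.4 (1)] -/
theorem typeRank_eq_of_primitive_of_hasConstantRows (hp2 : p ≠ 2) (hσ : orderOf σ = p ^ 2)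
    (hρσ : ρ ∉ Subgroup.zpowers σ) (hcard : Fintype.card G = 2 * p ^ 2) (h : IsCMTypeWith ρ (Φ : Set G))
    (hprim : ∀ u : G, u ≠ 1 → ¬ IsStableUnder Φ u) (hr : HasConstantRows p p Φ (σ ^ p) σ) :
    typeRank G (Φ : Set G) = (p - 1) * p + 2 := by
  classical
  have hs := (forall_not_isStableUnder_iff hp2 hσ hρσ hcard h).1 hprim
  have key := typeRank_add_defect_eq hp2 hσ hρσ hcard h
  rw [if_pos hr, if_neg hs, add_zero] at key
  have hp1 := hp.out.one_lt
  have e : (p - 1) * p + 2 + (p - 1) = p ^ 2 + 1 := by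
    zify [hp1.le]
    ring
  omega

/-- **The rank of a PRIMITIVE type whose rows are not constant is `p² + 1`** (nondegenerate): Dodson's orbits of
order `9` with `rank(f) = 10`. [cite: Dodson1987, Prop. 4.4 (1)] -/
theorem typeRank_eq_of_primitive_of_not_hasConstantRows (hp2 : p ≠ 2) (hσ : orderOf σ = p ^ 2)
    (hρσ : ρ ∉ Subgroup.zpowers σ) (hcard : Fintype.card G = 2 * p ^ 2) (h : IsCMTypeWith ρ (Φ : Set G))
    (hprim : ∀ u : G, u ≠ 1 → ¬ IsStableUnder Φ u) (hr : ¬ HasConstantRows p p Φ (σ ^ p) σ) :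
    typeRank G (Φ : Set G) = p ^ 2 + 1 :=
  (typeRank_eq_iff hp2 hσ hρσ hcard h).2 ⟨hr, (forall_not_isStableUnder_iff hp2 hσ hρσ hcard h).1 hprim⟩

/-- **DODSON 1987, PROPOSITION 4.4 (1), for every odd prime `p`.**  A PRIMITIVE CM type of the cyclic group of
order `2p²` has rank `p² + 1` (nondegenerate) or `(p − 1)p + 2`, the latter iff it meets the `p` cosets of the
subgroup of order `p` in constant numbers ("Suppose `R₀ = ℤ₉` and weight(`f`) `= 3`. Then the orbits of order
`9` give types with rank(`f`) `= 8` or `10`"). [cite: Dodson1987, Prop. 4.4 (1)] -/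
theorem typeRank_eq_or_of_primitive (hp2 : p ≠ 2) (hσ : orderOf σ = p ^ 2) (hρσ : ρ ∉ Subgroup.zpowers σ)
    (hcard : Fintype.card G = 2 * p ^ 2) (h : IsCMTypeWith ρ (Φ : Set G))
    (hprim : ∀ u : G, u ≠ 1 → ¬ IsStableUnder Φ u) :
    typeRank G (Φ : Set G) = p ^ 2 + 1 ∨ typeRank G (Φ : Set G) = (p - 1) * p + 2 := by
  by_cases hr : HasConstantRows p p Φ (σ ^ p) σ
  · exact Or.inr (typeRank_eq_of_primitive_of_hasConstantRows hp2 hσ hρσ hcard h hprim hr)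
  · exact Or.inl (typeRank_eq_of_primitive_of_not_hasConstantRows hp2 hσ hρσ hcard h hprim hr)

/-- **A primitive type is degenerate iff its rows are constant.** [cite: Dodson1987, Prop. 4.4 (1)] -/
theorem typeRank_ne_iff_of_primitive (hp2 : p ≠ 2) (hσ : orderOf σ = p ^ 2) (hρσ : ρ ∉ Subgroup.zpowers σ)
    (hcard : Fintype.card G = 2 * p ^ 2) (h : IsCMTypeWith ρ (Φ : Set G))
    (hprim : ∀ u : G, u ≠ 1 → ¬ IsStableUnder Φ u) :
    typeRank G (Φ : Set G) ≠ p ^ 2 + 1 ↔ HasConstantRows p p Φ (σ ^ p) σ := by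
  rw [typeRank_ne_iff hp2 hσ hρσ hcard h]
  have hs := (forall_not_isStableUnder_iff hp2 hσ hρσ hcard h).1 hprim
  exact ⟨fun h' => h'.resolve_right hs, Or.inl⟩

/-- **The rank of an IMPRIMITIVE type (`σ^p S = S`) whose rows are not constant is `p + 1`** — these are the
types induced from the `2p - 2`... more precisely from the nondegenerate non-induced types of the index-`p`
quotient `⟨ρ⟩ × ℤ_p` (all `p² − p` faithful odd characters vanish, none of order `2p`): Dodson's `ℤ₉`-orbits of
order `3` other than `{0, ρ}`. [cite: Dodson1987, Prop. 4.4 (1)] [cite: Kubota1965, §4 Lemma 2] -/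
theorem typeRank_eq_of_isStableUnder_of_not_hasConstantRows (hp2 : p ≠ 2) (hσ : orderOf σ = p ^ 2)
    (hρσ : ρ ∉ Subgroup.zpowers σ) (hcard : Fintype.card G = 2 * p ^ 2) (h : IsCMTypeWith ρ (Φ : Set G))
    (hs : IsStableUnder Φ (σ ^ p)) (hr : ¬ HasConstantRows p p Φ (σ ^ p) σ) :
    typeRank G (Φ : Set G) = p + 1 := by
  classical
  have key := typeRank_add_defect_eq hp2 hσ hρσ hcard h
  rw [if_neg hr, if_pos hs, zero_add] at key
  have hpp : p ≤ p ^ 2 := by rw [sq]; exact Nat.le_mul_self p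
  omega

/-- **The rank of `S_even`, `S_odd` (`σ^p S = S` with constant rows, i.e. `S ⊇ ⟨σ⟩` or `S ∩ ⟨σ⟩ = ∅`) is
`2`** — the types induced from the imaginary quadratic level (every odd character but the one of order `2`
vanishes; the associated abelian varieties are powers of a CM elliptic curve). [cite: Kubota1965, §4 Lemma 2] -/
theorem typeRank_eq_two_of_isStableUnder_of_hasConstantRows (hp2 : p ≠ 2) (hσ : orderOf σ = p ^ 2)
    (hρσ : ρ ∉ Subgroup.zpowers σ) (hcard : Fintype.card G = 2 * p ^ 2) (h : IsCMTypeWith ρ (Φ : Set G))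
    (hs : IsStableUnder Φ (σ ^ p)) (hr : HasConstantRows p p Φ (σ ^ p) σ) :
    typeRank G (Φ : Set G) = 2 := by
  classical
  have key := typeRank_add_defect_eq hp2 hσ hρσ hcard h
  rw [if_pos hr, if_pos hs] at key
  have hp1 := hp.out.one_lt
  have hpp : p ≤ p ^ 2 := by rw [sq]; exact Nat.le_mul_self p
  omega

/-- **The four possible ranks**: every CM type of the cyclic group of order `2p²` has rank `p² + 1`,
`(p − 1)p + 2`, `p + 1` or `2` (Dodson, `p = 3`: `10, 8, 4, 2`). [cite: Dodson1987, Prop. 4.4 (1) and Remark 4.7] -/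
theorem typeRank_mem (hp2 : p ≠ 2) (hσ : orderOf σ = p ^ 2) (hρσ : ρ ∉ Subgroup.zpowers σ)
    (hcard : Fintype.card G = 2 * p ^ 2) (h : IsCMTypeWith ρ (Φ : Set G)) :
    typeRank G (Φ : Set G) ∈ ({p ^ 2 + 1, (p - 1) * p + 2, p + 1, 2} : Set ℕ) := by
  simp only [Set.mem_insert_iff, Set.mem_singleton_iff]
  by_cases hs : IsStableUnder Φ (σ ^ p)
  · by_cases hr : HasConstantRows p p Φ (σ ^ p) σ
    · exact Or.inr (Or.inr (Or.inr
        (typeRank_eq_two_of_isStableUnder_of_hasConstantRows hp2 hσ hρσ hcard h hs hr)))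
    · exact Or.inr (Or.inr (Or.inl
        (typeRank_eq_of_isStableUnder_of_not_hasConstantRows hp2 hσ hρσ hcard h hs hr)))
  · have hprim := (forall_not_isStableUnder_iff hp2 hσ hρσ hcard h).2 hs
    rcases typeRank_eq_or_of_primitive hp2 hσ hρσ hcard h hprim with e | e
    · exact Or.inl e
    · exact Or.inr (Or.inl e)

omit [Fintype G] in
/-- **Weights prime to `p` (Dodson's Prop. 4.1 for `R₀ = ℤ_{p²}`)**: if the number of points of `S` in the odd
part `⟨σ⟩` is prime to `p`, the rows cannot be constant (their common count `c` would give `pc` points).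
[cite: Dodson1987, Prop. 4.1] -/
theorem not_hasConstantRows_of_not_dvd
    (hnd : ¬ p ∣ (Finset.univ.filter fun xy : ZMod p × ZMod p =>
      (σ ^ p) ^ xy.1.val * σ ^ xy.2.val ∈ Φ).card) :
    ¬ HasConstantRows p p Φ (σ ^ p) σ := by
  intro hr
  apply hnd
  rw [← sum_rowCount_eq p p Φ (σ ^ p) σ, Finset.sum_congr rfl fun y _ => hr y 0, Finset.sum_const,
    Finset.card_univ, ZMod.card, smul_eq_mul]
  exact Dvd.intro _ rfl

/-- **Dodson's Prop. 4.1 for the cyclic group `R₀ = ℤ_{p²}`, with its exact rank**: a PRIMITIVE type whose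
weight on the odd part is prime to `p` is nondegenerate, `rank = p² + 1` ("the type defined by `f` is
nondegenerate whenever weight(`f`) is relatively prime to `3`"; the tree's `PrimePowerBlockNondegenerate` proves
Prop. 4.1 for every transitive group of prime-power degree by a different route).
[cite: Dodson1987, Prop. 4.1] -/
theorem typeRank_eq_of_primitive_of_not_dvd (hp2 : p ≠ 2) (hσ : orderOf σ = p ^ 2)
    (hρσ : ρ ∉ Subgroup.zpowers σ) (hcard : Fintype.card G = 2 * p ^ 2) (h : IsCMTypeWith ρ (Φ : Set G))
    (hprim : ∀ u : G, u ≠ 1 → ¬ IsStableUnder Φ u)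
    (hnd : ¬ p ∣ (Finset.univ.filter fun xy : ZMod p × ZMod p =>
      (σ ^ p) ^ xy.1.val * σ ^ xy.2.val ∈ Φ).card) :
    typeRank G (Φ : Set G) = p ^ 2 + 1 :=
  typeRank_eq_of_primitive_of_not_hasConstantRows hp2 hσ hρσ hcard h hprim (not_hasConstantRows_of_not_dvd hnd)

end Rank

/-! ## §7 Dimension `9` as printed: `⟨ρ⟩ × ℤ₉` (Dodson 1987, §4.1–§4.2) -/

section Nine

variable {G : Type*} [CommGroup G] [Fintype G] [DecidableEq G] {ρ σ : G} {Φ : Finset G}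

/-- **PROPOSITION 4.4 (1) as printed (`R₀ = ℤ₉`)**: a PRIMITIVE CM type of the cyclic group of order `18` (a
`ℤ₉`-orbit of order `9`) has rank `10` or `8` — "the orbits of order `9` give types with rank(`f`) `= 8` or
`10`". [cite: Dodson1987, Prop. 4.4 (1)] -/
theorem typeRank_eq_or_of_primitive_nine (hσ : orderOf σ = 9) (hρσ : ρ ∉ Subgroup.zpowers σ)
    (hcard : Fintype.card G = 18) (h : IsCMTypeWith ρ (Φ : Set G))
    (hprim : ∀ u : G, u ≠ 1 → ¬ IsStableUnder Φ u) :
    typeRank G (Φ : Set G) = 10 ∨ typeRank G (Φ : Set G) = 8 := by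
  haveI : Fact (Nat.Prime 3) := ⟨Nat.prime_three⟩
  exact typeRank_eq_or_of_primitive (p := 3) (by norm_num) (by rw [hσ]; norm_num) hρσ
    (by rw [hcard]; norm_num) h hprim

/-- **The rank-`8` orbits** ("three orbits of order `9` consist of types for which rank(`f`) `= 8`"; for weight
`3`: one point in each coset of `ℤ₃`): a primitive type has rank `8` iff it meets the three cosets of `ℤ₃ ⊂ ℤ₉`
in the same number of points. [cite: Dodson1987, Prop. 4.4 (1) (proof)] -/
theorem typeRank_eq_eight_iff_of_primitive_nine (hσ : orderOf σ = 9) (hρσ : ρ ∉ Subgroup.zpowers σ)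
    (hcard : Fintype.card G = 18) (h : IsCMTypeWith ρ (Φ : Set G))
    (hprim : ∀ u : G, u ≠ 1 → ¬ IsStableUnder Φ u) :
    typeRank G (Φ : Set G) = 8 ↔ HasConstantRows 3 3 Φ (σ ^ 3) σ := by
  haveI : Fact (Nat.Prime 3) := ⟨Nat.prime_three⟩
  have hσ' : orderOf σ = 3 ^ 2 := by rw [hσ]; norm_num
  have hcard' : Fintype.card G = 2 * 3 ^ 2 := by rw [hcard]; norm_num
  have hne := typeRank_ne_iff_of_primitive (p := 3) (by norm_num) hσ' hρσ hcard' h hprim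
  constructor
  · intro h8
    exact hne.1 (by rw [h8]; norm_num)
  · intro hr
    have := typeRank_eq_of_primitive_of_hasConstantRows (p := 3) (by norm_num) hσ' hρσ hcard' h hprim hr
    norm_num at this
    exact this

/-- **The imprimitive types of `⟨ρ⟩ × ℤ₉`** (`ℤ₉`-orbits of order `3`): rank `4`, or `2` for the orbit `{0, ρ}`.
[cite: Dodson1987, Prop. 4.4 (1)] [cite: Kubota1965, §4 Lemma 2] -/
theorem typeRank_eq_or_of_isStableUnder_nine (hσ : orderOf σ = 9) (hρσ : ρ ∉ Subgroup.zpowers σ)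
    (hcard : Fintype.card G = 18) (h : IsCMTypeWith ρ (Φ : Set G)) (hs : IsStableUnder Φ (σ ^ 3)) :
    typeRank G (Φ : Set G) = 4 ∨ typeRank G (Φ : Set G) = 2 := by
  haveI : Fact (Nat.Prime 3) := ⟨Nat.prime_three⟩
  have hσ' : orderOf σ = 3 ^ 2 := by rw [hσ]; norm_num
  have hcard' : Fintype.card G = 2 * 3 ^ 2 := by rw [hcard]; norm_num
  by_cases hr : HasConstantRows 3 3 Φ (σ ^ 3) σ
  · exact Or.inr (typeRank_eq_two_of_isStableUnder_of_hasConstantRows (p := 3) (by norm_num) hσ' hρσ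
      hcard' h hs hr)
  · exact Or.inl (typeRank_eq_of_isStableUnder_of_not_hasConstantRows (p := 3) (by norm_num) hσ' hρσ
      hcard' h hs hr)

/-- **REMARK 4.7, the cyclic part**: every CM type of the cyclic group of order `18` has rank `10, 8, 4` or `2`
(Dodson: "Let `A` be a simple Abelian variety with complex multiplication … dimension `9`. Then Rank(`A`)
`= 6, 8, or 10`" — the value `6` requires the non-cyclic group `ℤ₃²`, Prop. 4.4 (2b) and Prop. 4.6; on
`⟨ρ⟩ × ℤ₉` the simple (primitive) types have rank `8` or `10`). [cite: Dodson1987, Remark 4.7 and Prop. 4.4] -/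
theorem typeRank_mem_nine (hσ : orderOf σ = 9) (hρσ : ρ ∉ Subgroup.zpowers σ) (hcard : Fintype.card G = 18)
    (h : IsCMTypeWith ρ (Φ : Set G)) : typeRank G (Φ : Set G) ∈ ({10, 8, 4, 2} : Set ℕ) := by
  haveI : Fact (Nat.Prime 3) := ⟨Nat.prime_three⟩
  have := typeRank_mem (p := 3) (by norm_num) (by rw [hσ]; norm_num) hρσ (by rw [hcard]; norm_num) h
  norm_num at this
  simpa using this

end Nine

end PrimeSq

end CyclicCMType

end Literature.NumberTheory.ComplexMultiplication

end
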